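import Literature.Geometry.Riemannian.ExpMapGlobalSmooth
import Literature.Geometry.Riemannian.MaximalGeodesicRescaling
import Literature.Geometry.Manifold.InverseFunctionTheoremVectorSpace
import HarnessLib

/-!
# The differential of the exponential map at the origin (Lee 2018, Prop. 5.19 (b),(d))

Layer 3a of the proof programme for `Literature.Geometry.Riemannian.lee_expMap_injectivityDomain`
(Lee 2018, Thm. 10.34; see `ExponentialMapProofs.lean`, `GeodesicFlowSmooth.lean`,
`ExpMapGlobalSmooth.lean`). For a `C^k` connection `cov` on `TM` (`1 ≤ k ≤ ∞`, Hausdorff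
manifold without boundary):

* `mfderiv_expMap_zero_eq_id` — **`d(exp_x)_0 = id`** (general `C^k` form of `mfderiv_expMap_zero` of `ExponentialMapSmooth.lean`) under `T_0(T_x M) = T_x M = E` (Prop. 5.19 (d):
  "`d(exp_p)_0(v) = (d/dt)|_{t=0} exp_p(tv) = (d/dt)|_{t=0} γ_v(t) = v`");
* `isLocalDiffeomorphAt_expMap_zero_of_le` — **`exp_x` is a `C^k` local diffeomorphism at `0`** (inverse
  function theorem, `isLocalDiffeomorphAt_of_mfderiv_of_normedSpace`; Lee, Lemma 5.10 / proof of
  Prop. 5.19 (d) and of Thm. 5.11 (normal neighbourhoods)).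

No definitions, no named facts (D-0026).

## References

* J. M. Lee, *Introduction to Riemannian Manifolds*, 2nd ed. (2018), Lemma 5.18, Prop. 5.19.
  [LeeRiemannianManifolds2018]
-/

noncomputable section

open Bundle Set Filter
open scoped Manifold ContDiff Topology

namespace Literature.Geometry.Riemannian

open Literature.Geometry.Lorentzian

variable {E : Type*} [NormedAddCommGroup E] [NormedSpace ℝ E] {H : Type*} [TopologicalSpace H]
  {I : ModelWithCorners ℝ E H} {M : Type*} [TopologicalSpace M] [ChartedSpace H M]
  [IsManifold I ∞ M] [FiniteDimensional ℝ E]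
  {cov : CovariantDerivative I E (TangentSpace I : M → Type _)}
  [CompleteSpace E] [T2Space M] [BoundarylessManifold I M]
  [CovariantDerivative.ContMDiffCovariantDerivative cov 1]

/-! ### The differential of `exp_x` at `0` -/

variable {k : ℕ∞} [CovariantDerivative.ContMDiffCovariantDerivative cov k]

/-- `exp_x` is differentiable at `0` (it is `C^k`, `k ≥ 1`, on the open set `𝓔_x ∋ 0`).
[cite: LeeRiemannianManifolds2018, Prop. 5.19 (a)] -/
theorem mdifferentiableAt_expMap_zero (hk : 1 ≤ k) (x : M) :
    MDifferentiableAt 𝓘(ℝ, E) I (fun v : E ↦ expMap cov x (show TangentSpace I x from v)) 0 := by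
  have hk0 : ((k : ℕ∞ω)) ≠ 0 := by
    have : (1 : ℕ∞ω) ≤ k := by exact_mod_cast hk
    exact (lt_of_lt_of_le zero_lt_one this).ne'
  have h := contMDiffOn_expMap (cov := cov) hk x
  have h0 : {v : E | (show TangentSpace I x from v) ∈ expDomain cov x} ∈ 𝓝 (0 : E) :=
    (isOpen_expDomain (cov := cov) hk x).mem_nhds (zero_mem_expDomain (cov := cov) x)
  exact (h.contMDiffAt h0).mdifferentiableAt hk0

/-- **`d(exp_x)_0 = id`** (Lee 2018, Prop. 5.19 (d)): for `w ∈ T_x M`,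
`d(exp_x)_0(w) = (d/dt)|_{t=0} exp_x(tw) = γ_w'(0) = w` (the line `t ↦ tw` is mapped to `γ_w`
near `t = 0`, `smul_mem_expDomain_of_mem`). Under `T_0(T_xM) = T_xM = E` the differential is
Mathlib's `mfderiv` of `exp_x : E → M` at `0`. [cite: LeeRiemannianManifolds2018, Prop. 5.19 (d)] -/
theorem mfderiv_expMap_zero_apply (hk : 1 ≤ k) (x : M) (w : E) :
    mfderiv 𝓘(ℝ, E) I (fun v : E ↦ expMap cov x (show TangentSpace I x from v)) 0 w = w := by
  set f : E → M := fun v ↦ expMap cov x (show TangentSpace I x from v) with hf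
  have hdiff : MDifferentiableAt 𝓘(ℝ, E) I f 0 := mdifferentiableAt_expMap_zero (cov := cov) hk x
  -- the line `c t = t w` and its derivative
  set c : ℝ → E := fun t ↦ t • w with hc
  have hc0 : c 0 = 0 := zero_smul ℝ w
  have hcd : HasMFDerivAt 𝓘(ℝ, ℝ) 𝓘(ℝ, E) c 0
      (ContinuousLinearMap.toSpanSingleton ℝ ((1 : ℝ) • w)) :=
    hasMFDerivAt_iff_hasFDerivAt.2 ((hasDerivAt_id' (0 : ℝ)).smul_const w).hasFDerivAt
  have hdiff' : MDifferentiableAt 𝓘(ℝ, E) I f (c 0) := by rw [hc0]; exact hdiff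
  have hcomp : HasMFDerivAt 𝓘(ℝ, ℝ) I (f ∘ c) 0
      ((mfderiv 𝓘(ℝ, E) I f (c 0)).comp (ContinuousLinearMap.toSpanSingleton ℝ ((1 : ℝ) • w))) :=
    hdiff'.hasMFDerivAt.comp 0 hcd
  have hvel : velocity I (f ∘ c) 0 = mfderiv 𝓘(ℝ, E) I f (c 0) w := by
    have h1 : mfderiv 𝓘(ℝ, ℝ) I (f ∘ c) 0 =
        (mfderiv 𝓘(ℝ, E) I f (c 0)).comp (ContinuousLinearMap.toSpanSingleton ℝ ((1 : ℝ) • w)) :=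
      hcomp.mfderiv
    show mfderiv 𝓘(ℝ, ℝ) I (f ∘ c) 0 1 = _
    rw [h1]
    have h2 : (ContinuousLinearMap.toSpanSingleton ℝ ((1 : ℝ) • w)) (1 : ℝ) = w := by simp
    exact congrArg (mfderiv 𝓘(ℝ, E) I f (c 0)) h2
  -- `f ∘ c = γ_w` near `0`
  obtain ⟨hmax, hD0, -, hv0⟩ := maximalGeodesic_spec' (cov := cov) x (show TangentSpace I x from w)
  have heq : (f ∘ c) =ᶠ[𝓝 0] maximalGeodesic cov x (show TangentSpace I x from w) := by
    filter_upwards [hmax.isOpen.mem_nhds hD0] with t ht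
    exact (expMap_smul_of_mem (cov := cov) x (show TangentSpace I x from w) ht).2
  have hvel' : velocity I (f ∘ c) 0 = w := by
    rw [velocity_congr_of_eventuallyEq (I := I) heq]
    exact hv0
  rw [hc0] at hvel
  rw [← hvel]
  exact hvel'

/-- **`d(exp_x)_0 = id`** as an identity of continuous linear maps `E →L[ℝ] E`
(Lee 2018, Prop. 5.19 (d)). [cite: LeeRiemannianManifolds2018, Prop. 5.19 (d)] -/
theorem mfderiv_expMap_zero_eq_id (hk : 1 ≤ k) (x : M) :
    mfderiv 𝓘(ℝ, E) I (fun v : E ↦ expMap cov x (show TangentSpace I x from v)) 0 =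
      ((ContinuousLinearEquiv.refl ℝ E : E ≃L[ℝ] E) : E →L[ℝ] E) :=
  ContinuousLinearMap.ext fun w ↦ mfderiv_expMap_zero_apply (cov := cov) hk x w

/-- **`exp_x` is a `C^k` local diffeomorphism at `0 ∈ T_x M`** (Lee 2018, Lemma 5.10 and
Prop. 5.19 (d): `d(exp_p)_0` is the identity, so the inverse function theorem applies).
[cite: LeeRiemannianManifolds2018, Prop. 5.19 (d)] -/
theorem isLocalDiffeomorphAt_expMap_zero_of_le (hk : 1 ≤ k) (x : M) :
    IsLocalDiffeomorphAt 𝓘(ℝ, E) I k (fun v : E ↦ expMap cov x (show TangentSpace I x from v)) 0 := by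
  have hk0 : ((k : ℕ∞ω)) ≠ 0 := by
    have : (1 : ℕ∞ω) ≤ k := by exact_mod_cast hk
    exact (lt_of_lt_of_le zero_lt_one this).ne'
  exact Manifold.isLocalDiffeomorphAt_of_mfderiv_of_normedSpace hk0
    (isOpen_expDomain (cov := cov) hk x) (zero_mem_expDomain (cov := cov) x)
    (contMDiffOn_expMap (cov := cov) hk x) (ContinuousLinearEquiv.refl ℝ E)
    (mfderiv_expMap_zero_eq_id (cov := cov) hk x)

end Literature.Geometry.Riemannian
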